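import Summits.QuantumFields.YangMills.Theorems.WilsonVillainDualStiffnessHartmanWatsonMixtureDefs
import Literature.Probability.HartmanWatson1974.VonMisesMixture
import Mathlib.Analysis.SpecificLimits.Basic
import Mathlib.Analysis.Complex.Exponential
import HarnessLib

/-!
# Route `WilsonVillainDualStiffness` / `WilsonVillainPerimeterTransfer`, shared crux stmt-QuantumFields-26809
# `HartmanWatsonMixture`: the registered stub `stub_arcMassLowerBound` (two-regime arc-mass lower bound)

Stub `stub_arcMassLowerBound` of the registered BC3 skeleton v2 of the shared crux `HartmanWatsonMixture` (planner
`ym-idea-3` g6, birth file `HartmanWatsonMixture_birth_v2.lean`, sha256 a1776bf4…; the skeleton's other stubs are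
`stub_mixingMeasureExists` = the named fact Hartman–Watson 1974 and `stub_tailFromArcBound`, untouched here), with the
REGISTERED signature verbatim, `arcMass` being the route-posited object of the D-0016 Defs companion
`WilsonVillainDualStiffnessHartmanWatsonMixtureDefs.lean` (character-identical to the skeleton's local definition):

  `∀ a ∈ (0, 33/10], ∀ t ≥ a:  min (g a) ((1/20)/π) ≤ arcMass t`,  `g a = (1/5)·(2πa)^{-1/2}·e^{-(109/50)²/(2a)}`,

where `arcMass t = P_t(J) = (1/2π)∫_{[-π,π]} 1_J p_t(e^{iθ}) dθ` is the circle-heat-kernel mass of the witness arc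
`J = {104/50 ≤ |θ| ≤ 109/50}` (`θ₀ = 2.13`, `δ = 0.05`, `|J| = 1/5`).  PROOF (the planner's two regimes, critic idea-crit-4
09:10:32Z — `P_t(J)` is not monotone in `t`, so neither regime alone suffices):

* §1 pointwise kernel bounds.  (i) For `t > 0`, `|θ| ≤ 109/50`: `p_t(e^{iθ}) = √(2π/t)∑ₘ e^{-(θ+2πm)²/(2t)}` (tree
  `circleHeatKernel_exp_eq_villainKernel`, Poisson summation) `≥` its `m = 0` term (tree `exp_le_villainKernel`)
  `≥ √(2π/t) e^{-(109/50)²/(2t)}` (`kernel_ge_gauss`).  (ii) For `t ≥ 33/10` and every `z`: from the Fourier series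
  `p_t(z) = ∑ₙ e^{-n²t/2} Re zⁿ` (the definition), `Re zⁿ ≥ -1`, `Re z⁰ = 1`: `p_t(z) ≥ 2 − ∑ₙ e^{-n²t/2} ≥ 2 − (1+q)/(1−q)`
  with `q = e^{-t/2}` (compare `e^{-n²t/2} ≤ q^{|n|}` with the geometric series on `ℕ` and on `-(ℕ+1)`), and
  `q ≤ e^{-33/20} ≤ 1/5` (`e^{33/20} = (e^{33/80})⁴ ≥ (1 + 33/80 + (33/80)²/2)⁴ ≥ 5`), so `p_t ≥ (1−3q)/(1−q) ≥ 1/2`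
  (`half_le_kernel`).
* §2 `arcMass t = (∫_{[-109/50,-104/50]} p_t + ∫_{[104/50,109/50]} p_t)/(2π)` (indicator bookkeeping, `J ⊆ [-π, π]` since
  `109/50 < π`), hence a pointwise bound `c ≤ p_t` on `|θ| ≤ 109/50` gives `c/(10π) ≤ arcMass t` (`arcMass_ge`; each interval
  has length `1/10`).
* §3 regime (i) gives `g t ≤ arcMass t` (`g_le_arcMass`: `√(2π/t)/(10π) = (1/5)/√(2πt)`), and `g` is non-decreasing on
  `(0, (109/50)²]` (`g_mono`: squared, it is `t e^{-s/a} ≤ a e^{-s/t}`, `s = (109/50)²`, which follows from `e^y ≥ 1 + y` and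
  `(t−a)(t−s) ≤ 0`); regime (ii) gives `(1/20)/π = (1/2)/(10π) ≤ arcMass t` for `t ≥ 33/10` (`const_le_arcMass`); since
  `a ≤ 33/10 ≤ (109/50)² = 4.7524`, every `t ≥ a` is in one of the two regimes (`stub_arcMassLowerBound`).

Honest label: one elementary real-analysis stub of an OPEN crux on DRAFT-by-design routes (nodes `U1HelicityGapTorusD4`,
`AbelianDeconfinementD4`); nothing about the Hartman–Watson law, the crux, the nodes or any summit statement is proved here.
No named facts; no `sorry`; default heartbeats.  Seat `ym-line-frs-p2` g9 (free hands, announced on the owner's bus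
2026-08-28), `--supports stmt-QuantumFields-26809`.

References: E. M. Stein, *Topics in Harmonic Analysis* (1970), Ch. II §2 (circle heat kernel, Poisson summation);
P. Hartman, G. S. Watson, Ann. Probab. 2 (1974) 593–607.
-/

noncomputable section

namespace Summit.QuantumFields.YangMills.Cruxes.HartmanWatsonMixture

namespace ArcMass

open MeasureTheory Set Filter
open Literature.MathematicalPhysics.QuantumLattice (circleHeatKernel circleHeatKernel_nonneg
  continuous_circleHeatKernel circleHeatKernel_summable_coeff)
open Literature.MathematicalPhysics.QuantumFieldTheory (villainKernel exp_le_villainKernel)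
open Literature.Probability.HartmanWatson1974 (circleHeatKernel_exp_eq_villainKernel)

/-! ## §1 Pointwise lower bounds on the circle heat kernel -/

/-- Regime (i) — the `m = 0` Villain term: for `t > 0` and `|θ| ≤ 109/50`,
`√(2π/t)·e^{-(109/50)²/(2t)} ≤ p_t(e^{iθ})` (`p_t(e^{iθ}) = √(2π/t) ∑ₘ e^{-(θ+2πm)²/(2t)}`, all terms `≥ 0`). -/
theorem kernel_ge_gauss {t θ : ℝ} (ht : 0 < t) (hθ : |θ| ≤ 109 / 50) :
    Real.sqrt (2 * Real.pi * t⁻¹) * Real.exp (-(t⁻¹ / 2) * (109 / 50) ^ 2) ≤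
      circleHeatKernel t (Circle.exp θ) := by
  rw [circleHeatKernel_exp_eq_villainKernel ht θ]
  refine mul_le_mul_of_nonneg_left ?_ (Real.sqrt_nonneg _)
  refine le_trans (Real.exp_le_exp.2 ?_) (exp_le_villainKernel (inv_pos.2 ht) θ)
  have h1 := abs_le.1 hθ
  have hθ2 : θ ^ 2 ≤ (109 / 50) ^ 2 := by nlinarith [h1.1, h1.2]
  have hti : 0 ≤ t⁻¹ / 2 := by positivity
  nlinarith

/-- `e^{33/20} ≥ 5` (from `e^x ≥ 1 + x + x²/2` at `x = 33/80`, raised to the fourth power). -/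
theorem five_le_exp : (5 : ℝ) ≤ Real.exp (33 / 20) := by
  have h := Real.quadratic_le_exp_of_nonneg (show (0 : ℝ) ≤ 33 / 80 by norm_num)
  have h4 : Real.exp (33 / 20) = Real.exp (33 / 80) ^ 4 := by
    rw [← Real.exp_nat_mul]; norm_num
  rw [h4]
  calc (5 : ℝ) ≤ (1 + 33 / 80 + (33 / 80) ^ 2 / 2) ^ 4 := by norm_num
    _ ≤ Real.exp (33 / 80) ^ 4 := pow_le_pow_left₀ (by norm_num) h 4

/-- For `t ≥ 33/10`: `q := e^{-t/2} ≤ 1/5`. -/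
theorem exp_neg_half_le {t : ℝ} (ht : 33 / 10 ≤ t) : Real.exp (-(t / 2)) ≤ 1 / 5 := by
  have h1 : Real.exp (-(t / 2)) ≤ Real.exp (-(33 / 20)) := Real.exp_le_exp.2 (by linarith)
  refine h1.trans ?_
  rw [Real.exp_neg, inv_le_comm₀ (Real.exp_pos _) (by norm_num : (0 : ℝ) < 1 / 5)]
  norm_num
  exact five_le_exp

/-- Regime (ii) — for `t ≥ 33/10` the heat kernel is at least `1/2` everywhere:
`p_t(z) = ∑ₙ e^{-n²t/2} Re zⁿ ≥ 2 − ∑ₙ e^{-n²t/2} ≥ 2 − (1+q)/(1−q) = (1−3q)/(1−q) ≥ 1/2`, `q = e^{-t/2} ≤ 1/5`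
(compare `e^{-n²t/2} ≤ qⁿ` with the geometric series). -/
theorem half_le_kernel {t : ℝ} (ht : 33 / 10 ≤ t) (z : Circle) : (1 : ℝ) / 2 ≤ circleHeatKernel t z := by
  have ht0 : 0 < t := by linarith
  set q : ℝ := Real.exp (-(t / 2)) with hq
  have hq0 : 0 < q := Real.exp_pos _
  have hq5 : q ≤ 1 / 5 := exp_neg_half_le ht
  have hq1 : q < 1 := by linarith
  -- the Gaussian coefficients
  set a : ℤ → ℝ := fun n => Real.exp (-(n : ℝ) ^ 2 * t / 2) with ha
  have ha_nn : ∀ n, 0 ≤ a n := fun n => (Real.exp_pos _).le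
  have hsum_a : Summable a := circleHeatKernel_summable_coeff ht0
  -- the terms of `p_t(z)`
  set f : ℤ → ℝ := fun n => Real.exp (-(n : ℝ) ^ 2 * t / 2) * ((z ^ n : Circle) : ℂ).re with hf
  have hre : ∀ n : ℤ, |((z ^ n : Circle) : ℂ).re| ≤ 1 := fun n =>
    (Complex.abs_re_le_norm _).trans (Circle.norm_coe _).le
  have hf_le : ∀ n, ‖f n‖ ≤ a n := by
    intro n
    rw [hf, ha, Real.norm_eq_abs, abs_mul, abs_of_pos (Real.exp_pos _)]
    exact mul_le_of_le_one_right (Real.exp_pos _).le (hre n)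
  have hsum_f : Summable f := Summable.of_norm_bounded hsum_a hf_le
  -- the comparison family `g n = 2·[n = 0] − a n ≤ f n`
  set g : ℤ → ℝ := fun n => (if n = 0 then (2 : ℝ) else 0) - a n with hg
  have hg_le : ∀ n, g n ≤ f n := by
    intro n
    by_cases hn : n = 0
    · subst hn
      simp [hg, hf, ha]
      norm_num
    · simp only [hg, hf, ha, hn, if_false, zero_sub]
      have h1 := (abs_le.1 (hre n)).1
      nlinarith [ha_nn n, Real.exp_pos (-(n : ℝ) ^ 2 * t / 2)]
  have hsum_ind : Summable (fun n : ℤ => if n = 0 then (2 : ℝ) else 0) :=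
    summable_of_ne_finset_zero (s := {0}) (by intro n hn; simp only [Finset.mem_singleton] at hn; simp [hn])
  have hsum_g : Summable g := hsum_ind.sub hsum_a
  have h1 : ∑' n, g n ≤ ∑' n, f n := Summable.tsum_le_tsum hg_le hsum_g hsum_f
  have h2 : ∑' n, g n = 2 - ∑' n, a n := by
    rw [hg, hsum_ind.tsum_sub hsum_a, tsum_ite_eq]
  -- `S = ∑ₙ a n ≤ 1/(1−q) + q/(1−q)`
  have hgeom : HasSum (fun n : ℕ => q ^ n) (1 - q)⁻¹ := hasSum_geometric_of_lt_one hq0.le hq1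
  have hterm : ∀ n : ℕ, Real.exp (-((n : ℝ) + 1) ^ 2 * t / 2) ≤ q ^ (n + 1) ∧
      Real.exp (-(n : ℝ) ^ 2 * t / 2) ≤ q ^ n := by
    intro n
    have hn : (0 : ℝ) ≤ n := Nat.cast_nonneg n
    constructor
    · rw [hq, ← Real.exp_nat_mul]
      refine Real.exp_le_exp.2 ?_
      push_cast
      nlinarith [mul_nonneg (mul_nonneg hn (show (0 : ℝ) ≤ (n : ℝ) + 1 by positivity)) ht0.le]
    · rw [hq, ← Real.exp_nat_mul]
      refine Real.exp_le_exp.2 ?_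
      have hnn : (n : ℝ) ≤ (n : ℝ) ^ 2 := by
        rw [sq]; exact_mod_cast Nat.le_mul_self n
      nlinarith
  have hnat : Summable (fun n : ℕ => a n) := hsum_a.comp_injective Nat.cast_injective
  have hneg : Summable (fun n : ℕ => a (-(n + 1))) := by
    refine hsum_a.comp_injective (fun m n hmn => ?_)
    have := neg_injective hmn
    exact_mod_cast (add_left_injective _ this : (m : ℤ) = n)
  have hb1 : ∑' n : ℕ, a n ≤ (1 - q)⁻¹ := by
    refine (Summable.tsum_le_tsum (fun n => ?_) hnat hgeom.summable).trans_eq hgeom.tsum_eq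
    simp only [ha, Int.cast_natCast]
    exact (hterm n).2
  have hb2 : ∑' n : ℕ, a (-(n + 1)) ≤ q * (1 - q)⁻¹ := by
    have hgeom' := hgeom.mul_left q
    refine (Summable.tsum_le_tsum (fun n => ?_) hneg hgeom'.summable).trans_eq hgeom'.tsum_eq
    simp only [ha, Int.cast_neg, Int.cast_add, Int.cast_natCast, Int.cast_one, neg_sq, ← pow_succ']
    exact (hterm n).1
  have hS : ∑' n, a n ≤ (1 - q)⁻¹ + q * (1 - q)⁻¹ := by
    rw [tsum_of_nat_of_neg_add_one hnat hneg]
    exact add_le_add hb1 hb2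
  -- combine
  have hq' : (1 - q)⁻¹ + q * (1 - q)⁻¹ ≤ 3 / 2 := by
    rw [show (1 - q)⁻¹ + q * (1 - q)⁻¹ = (1 + q) / (1 - q) by field_simp]
    rw [div_le_iff₀ (by linarith)]
    linarith
  have hp : circleHeatKernel t z = ∑' n, f n := rfl
  rw [hp]
  linarith [h1, h2, hS, hq']

/-! ## §2 From pointwise kernel bounds to the arc mass -/

/-- The indicator in `arcMass` is the indicator of the two intervals `[-109/50, -104/50] ∪ [104/50, 109/50]`. -/
theorem ite_mul_eq_indicator (f : ℝ → ℝ) (θ : ℝ) :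
    (if (104 / 50 : ℝ) ≤ |θ| ∧ |θ| ≤ 109 / 50 then (1 : ℝ) else 0) * f θ =
      (Set.Icc (-(109 / 50 : ℝ)) (-(104 / 50)) ∪ Set.Icc (104 / 50 : ℝ) (109 / 50)).indicator f θ := by
  rw [Set.indicator_apply]
  by_cases h : (104 / 50 : ℝ) ≤ |θ| ∧ |θ| ≤ 109 / 50
  · have hmem : θ ∈ Set.Icc (-(109 / 50 : ℝ)) (-(104 / 50)) ∪ Set.Icc (104 / 50 : ℝ) (109 / 50) := by
      rcases h with ⟨h1, h2⟩
      by_cases hθ : 0 ≤ θ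
      · rw [abs_of_nonneg hθ] at h1 h2
        exact Or.inr ⟨h1, h2⟩
      · rw [abs_of_neg (lt_of_not_ge hθ)] at h1 h2
        exact Or.inl ⟨by linarith, by linarith⟩
    rw [if_pos h, if_pos hmem, one_mul]
  · have hnmem : θ ∉ Set.Icc (-(109 / 50 : ℝ)) (-(104 / 50)) ∪ Set.Icc (104 / 50 : ℝ) (109 / 50) := by
      intro hmem
      apply h
      rcases hmem with ⟨h1, h2⟩ | ⟨h1, h2⟩
      · have hθ : θ < 0 := by linarith
        rw [abs_of_neg hθ]
        exact ⟨by linarith, by linarith⟩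
      · have hθ : 0 ≤ θ := by linarith
        rw [abs_of_nonneg hθ]
        exact ⟨h1, h2⟩
    rw [if_neg h, if_neg hnmem, zero_mul]

/-- `arcMass t` as the sum of the heat-kernel integrals over the two intervals (`t > 0`). -/
theorem arcMass_eq {t : ℝ} (ht : 0 < t) :
    arcMass t = ((∫ θ in Set.Icc (-(109 / 50 : ℝ)) (-(104 / 50)), circleHeatKernel t (Circle.exp θ)) +
      ∫ θ in Set.Icc (104 / 50 : ℝ) (109 / 50), circleHeatKernel t (Circle.exp θ)) / (2 * Real.pi) := by
  have hcont : Continuous fun θ : ℝ => circleHeatKernel t (Circle.exp θ) :=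
    (continuous_circleHeatKernel ht).comp Circle.exp.continuous
  have hpi : (109 / 50 : ℝ) < Real.pi := by linarith [Real.pi_gt_three]
  have hsub : Set.Icc (-(109 / 50 : ℝ)) (-(104 / 50)) ∪ Set.Icc (104 / 50 : ℝ) (109 / 50) ⊆
      Set.Icc (-Real.pi) Real.pi := by
    rintro θ (⟨h1, h2⟩ | ⟨h1, h2⟩) <;> exact ⟨by linarith, by linarith⟩
  have hmeas : MeasurableSet (Set.Icc (-(109 / 50 : ℝ)) (-(104 / 50)) ∪ Set.Icc (104 / 50 : ℝ) (109 / 50)) :=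
    measurableSet_Icc.union measurableSet_Icc
  have hdisj : Disjoint (Set.Icc (-(109 / 50 : ℝ)) (-(104 / 50))) (Set.Icc (104 / 50 : ℝ) (109 / 50)) := by
    rw [Set.disjoint_iff]
    rintro θ ⟨⟨-, h2⟩, ⟨h3, -⟩⟩
    linarith
  unfold arcMass
  rw [setIntegral_congr_fun measurableSet_Icc
      (fun θ _ => ite_mul_eq_indicator (fun θ => circleHeatKernel t (Circle.exp θ)) θ),
    setIntegral_indicator hmeas, Set.inter_eq_right.2 hsub,
    setIntegral_union hdisj measurableSet_Icc (hcont.integrableOn_Icc) (hcont.integrableOn_Icc)]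

/-- A pointwise lower bound `c ≤ p_t(e^{iθ})` on `|θ| ≤ 109/50` gives `c/(10π) ≤ arcMass t`
(`|J| = 1/5`, density w.r.t. `dθ/2π`). -/
theorem arcMass_ge {t c : ℝ} (ht : 0 < t)
    (hc : ∀ θ : ℝ, |θ| ≤ 109 / 50 → c ≤ circleHeatKernel t (Circle.exp θ)) :
    c / (10 * Real.pi) ≤ arcMass t := by
  have hcont : Continuous fun θ : ℝ => circleHeatKernel t (Circle.exp θ) :=
    (continuous_circleHeatKernel ht).comp Circle.exp.continuous
  rw [arcMass_eq ht]
  have hI₁ : c * (1 / 10) ≤ ∫ θ in Set.Icc (-(109 / 50 : ℝ)) (-(104 / 50)), circleHeatKernel t (Circle.exp θ) := by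
    have h := setIntegral_ge_of_const_le_real (μ := volume) (s := Set.Icc (-(109 / 50 : ℝ)) (-(104 / 50)))
      (f := fun θ => circleHeatKernel t (Circle.exp θ)) (c := c) measurableSet_Icc
      (by rw [Real.volume_Icc]; exact ENNReal.ofReal_ne_top)
      (fun θ hθ => hc θ (by rw [abs_le]; exact ⟨by linarith [hθ.1], by linarith [hθ.2]⟩)) hcont.integrableOn_Icc
    rwa [Real.volume_real_Icc_of_le (by norm_num), show (-(104 / 50 : ℝ)) - (-(109 / 50)) = 1 / 10 by norm_num] at h
  have hI₂ : c * (1 / 10) ≤ ∫ θ in Set.Icc (104 / 50 : ℝ) (109 / 50), circleHeatKernel t (Circle.exp θ) := by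
    have h := setIntegral_ge_of_const_le_real (μ := volume) (s := Set.Icc (104 / 50 : ℝ) (109 / 50))
      (f := fun θ => circleHeatKernel t (Circle.exp θ)) (c := c) measurableSet_Icc
      (by rw [Real.volume_Icc]; exact ENNReal.ofReal_ne_top)
      (fun θ hθ => hc θ (by rw [abs_le]; exact ⟨by linarith [hθ.1], by linarith [hθ.2]⟩)) hcont.integrableOn_Icc
    rwa [Real.volume_real_Icc_of_le (by norm_num), show (109 / 50 : ℝ) - 104 / 50 = 1 / 10 by norm_num] at h
  have hπ : 0 < Real.pi := Real.pi_pos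
  calc c / (10 * Real.pi) = (c * (1 / 10) + c * (1 / 10)) / (2 * Real.pi) := by ring
    _ ≤ _ := div_le_div_of_nonneg_right (add_le_add hI₁ hI₂) (by positivity)

/-! ## §3 The two regimes and the registered stub -/

/-- Regime (i), `g` is non-decreasing on `(0, (109/50)²]`:
`g(x) = (1/5)(2πx)^{-1/2} e^{-(109/50)²/(2x)}`; `(t−a)(t−(109/50)²) ≤ 0` and `e^y ≥ 1+y` give `g a ≤ g t`. -/
theorem g_mono {a t : ℝ} (ha : 0 < a) (hat : a ≤ t) (hts : t ≤ (109 / 50) ^ 2) :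
    (1 / 5) / Real.sqrt (2 * Real.pi * a) * Real.exp (-((109 / 50) ^ 2) / (2 * a)) ≤
      (1 / 5) / Real.sqrt (2 * Real.pi * t) * Real.exp (-((109 / 50) ^ 2) / (2 * t)) := by
  have ht : 0 < t := lt_of_lt_of_le ha hat
  set s : ℝ := (109 / 50) ^ 2 with hs
  have hπ : 0 < Real.pi := Real.pi_pos
  -- key real inequality: `t·e^{-s/a} ≤ a·e^{-s/t}`
  have key : t * Real.exp (-s / (2 * a)) ^ 2 ≤ a * Real.exp (-s / (2 * t)) ^ 2 := by
    rw [← Real.exp_nat_mul, ← Real.exp_nat_mul]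
    have hexp : Real.exp ((2 : ℕ) * (-s / (2 * t))) = Real.exp ((2 : ℕ) * (-s / (2 * a))) * Real.exp (s / a - s / t) := by
      rw [← Real.exp_add]; congr 1; push_cast; field_simp; ring
    rw [hexp]
    have h1 : 1 + (s / a - s / t) ≤ Real.exp (s / a - s / t) := by
      linarith [Real.add_one_le_exp (s / a - s / t)]
    have h2 : t ≤ a * (1 + (s / a - s / t)) := by
      rw [show a * (1 + (s / a - s / t)) = ((a + s) * t - s * a) / t by field_simp; ring]
      rw [le_div_iff₀ ht]
      nlinarith [mul_nonpos_iff.2 (Or.inl ⟨sub_nonneg.2 hat, sub_nonpos.2 hts⟩)]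
    have h3 : t ≤ a * Real.exp (s / a - s / t) := h2.trans (mul_le_mul_of_nonneg_left h1 ha.le)
    calc t * Real.exp ((2 : ℕ) * (-s / (2 * a)))
        ≤ (a * Real.exp (s / a - s / t)) * Real.exp ((2 : ℕ) * (-s / (2 * a))) :=
          mul_le_mul_of_nonneg_right h3 (Real.exp_pos _).le
      _ = a * (Real.exp ((2 : ℕ) * (-s / (2 * a))) * Real.exp (s / a - s / t)) := by ring
  -- squares of both sides
  have hsq : ∀ x : ℝ, 0 < x → ((1 / 5) / Real.sqrt (2 * Real.pi * x) * Real.exp (-s / (2 * x))) ^ 2 =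
      (1 / 25) * (Real.exp (-s / (2 * x)) ^ 2 / (2 * Real.pi * x)) := by
    intro x hx
    rw [mul_pow, div_pow, Real.sq_sqrt (by positivity)]
    ring
  have hnonneg : ∀ x : ℝ, 0 < x → 0 ≤ (1 / 5) / Real.sqrt (2 * Real.pi * x) * Real.exp (-s / (2 * x)) :=
    fun x hx => by positivity
  rw [← pow_le_pow_iff_left₀ (hnonneg a ha) (hnonneg t ht) two_ne_zero, hsq a ha, hsq t ht]
  refine mul_le_mul_of_nonneg_left ?_ (by norm_num)
  rw [div_le_div_iff₀ (by positivity) (by positivity)]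
  calc Real.exp (-s / (2 * a)) ^ 2 * (2 * Real.pi * t) = (2 * Real.pi) * (t * Real.exp (-s / (2 * a)) ^ 2) := by ring
    _ ≤ (2 * Real.pi) * (a * Real.exp (-s / (2 * t)) ^ 2) := mul_le_mul_of_nonneg_left key (by positivity)
    _ = Real.exp (-s / (2 * t)) ^ 2 * (2 * Real.pi * a) := by ring

/-- Regime (i) at time `t`: `g(t) ≤ arcMass t` for `t > 0`. -/
theorem g_le_arcMass {t : ℝ} (ht : 0 < t) :
    (1 / 5) / Real.sqrt (2 * Real.pi * t) * Real.exp (-((109 / 50) ^ 2) / (2 * t)) ≤ arcMass t := by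
  have h := arcMass_ge ht (fun θ hθ => kernel_ge_gauss ht hθ)
  refine le_trans (le_of_eq ?_) h
  have hπ : 0 < Real.pi := Real.pi_pos
  have ht' : t ≠ 0 := ht.ne'
  have hne : Real.sqrt (2 * Real.pi * t) ≠ 0 := (Real.sqrt_pos.2 (by positivity)).ne'
  have hprod : Real.sqrt (2 * Real.pi * t⁻¹) * Real.sqrt (2 * Real.pi * t) = 2 * Real.pi := by
    rw [← Real.sqrt_mul (by positivity),
      show 2 * Real.pi * t⁻¹ * (2 * Real.pi * t) = (2 * Real.pi) ^ 2 by field_simp,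
      Real.sqrt_sq (by positivity)]
  have hsq : Real.sqrt (2 * Real.pi * t⁻¹) = 2 * Real.pi / Real.sqrt (2 * Real.pi * t) := by
    rw [eq_div_iff hne]; exact hprod
  have hexp : Real.exp (-((109 / 50 : ℝ) ^ 2) / (2 * t)) = Real.exp (-(t⁻¹ / 2) * (109 / 50) ^ 2) := by
    congr 1; ring
  rw [hsq, hexp]
  field_simp
  ring

/-- Regime (ii) at time `t ≥ 33/10`: `(1/20)/π ≤ arcMass t`. -/
theorem const_le_arcMass {t : ℝ} (ht : 33 / 10 ≤ t) : (1 / 20) / Real.pi ≤ arcMass t := by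
  have ht0 : 0 < t := by linarith
  have h := arcMass_ge ht0 (fun θ _ => half_le_kernel ht (Circle.exp θ))
  exact le_trans (le_of_eq (by ring)) h

/-- **The registered stub `stub_arcMassLowerBound` of crux stmt-QuantumFields-26809** (skeleton v2, sha a1776bf4…), VERBATIM:
two-regime arc-mass lower bound for the witness arc `J = {104/50 ≤ |θ| ≤ 109/50}` under the circle heat kernel. -/
theorem stub_arcMassLowerBound :
    ∀ a : ℝ, 0 < a → a ≤ 33 / 10 → ∀ t : ℝ, a ≤ t → min ((1 / 5) / Real.sqrt (2 * Real.pi * a) * Real.exp (-((109 / 50) ^ 2) / (2 * a))) ((1 / 20) / Real.pi) ≤ arcMass t := by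
  intro a ha ha33 t hat
  have ht : 0 < t := lt_of_lt_of_le ha hat
  by_cases hreg : t ≤ (109 / 50) ^ 2
  · exact (min_le_left _ _).trans ((g_mono ha hat hreg).trans (g_le_arcMass ht))
  · have ht33 : 33 / 10 ≤ t := by
      have := lt_of_not_ge hreg
      nlinarith
    exact (min_le_right _ _).trans (const_le_arcMass ht33)

end ArcMass

end Summit.QuantumFields.YangMills.Cruxes.HartmanWatsonMixture

end
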